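import Summits.BirchSwinnertonDyer.BirchSwinnertonDyer.Theorems.AlignedTransportAtTwoMainConjectureOfRankZeroBSDAtTwoSexticNormRelationDescentMu
import Literature.NumberTheory.EllipticCurves.ZpExtensionRestrictTwoSqrtTwo
import Literature.NumberTheory.EllipticCurves.NoEverywhereGoodReductionRat
import Literature.NumberTheory.EllipticCurves.GlobalMinimalModel
import HarnessLib

/-!
# Route `AlignedTransportAtTwo`, crux C2 `MainConjectureOfRankZeroBSDAtTwo` (stmt-BirchSwinnertonDyer-22298):
# THE `S₃` NORM-RELATION DESCENT AT `p = 2`, SIGN-FREE — part A: `√2 ∉ ℚ(W[2])` and `ℚ(W[2]) ∩ ℚ_∞ = ℚ` for BOTH signs of `Δ_W`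

Sequel of `…SexticNormRelationDescent{,Mu}` (seat bsd-line-att-p4 g28), written by the successor seat bsd-line-att-p4 g29. HONEST FRAMING: WIDTH-5
attached prover seat on line `birth` of the lead `bsd-line-att-p2`; `--supports` stmt-BirchSwinnertonDyer-22298, closes nothing; BSD is NOT proved; crux
C2, its verdict «blocked-on `Rank1Residual.GreenbergMuConjectureIrreducible`» and every registered stub untouched. THEOREMS ONLY.

WHY. Parts 1–2 assume `Δ_W < 0` at exactly two places: `¬ IsSquare Δ_W` (free for `Δ_W < 0`) and `T ∩ ℚ_∞ = ℚ` for `T = ℚ(W[2])` (proved there from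
«`T` totally complex over the odd-degree `ℚ(β₀)`»). The crux C2 quantifies over BOTH signs of `Δ` (`¬ IsSquare W.Δ` is one of its binders). This file
removes the sign: for `W/ℚ` elliptic with no rational `2`-torsion abscissa, `Δ_W` not a square and `2·Δ_W` not a square,

* §1 the Galois bookkeeping of part 1 under `¬ IsSquare Δ_W` only (`|Gal(T/ℚ)| = 6`, the fixing subgroups of the three cubic subfields have order `2`
  and are pairwise distinct, that of the resolvent `ℚ(δ)` (`δ = 4δ₀`, `δ² = Δ_W`) has order `3`, the `S₃` norm relation `3 = Σ N_{H_j} + N_C − N_G`);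
* §2 an elementary quadratic-extension lemma (`L = F ⊕ F·d`, `d² = m ∈ F`: an `x ∈ L` with `x² = 2` lies in `F` or `2m ∈ F²`) and its two uses:
  ★ `forall_sq_ne_two_divisionField_two` — **`√2 ∉ ℚ(W[2])`** (over `F = ℚ(β₀)` of odd degree `3`: `√2 ∈ ℚ(β₀)` or `√(2Δ_W) ∈ ℚ(β₀)` would be a
  quadratic subfield of a cubic field) — and `forall_sq_ne_two_resolvent` (`√2 ∉ ℚ(δ)`);
* §3 hence (`4 ∤ 6`, `4 ∤ 2`; tree `surjective_comp_absGaloisRestrict_of_forall_sq_ne_two`, Washington §13.1) ★ `surjective_gal_restrict_of_not_isSquare`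
  (`T ∩ ℚ_∞ = ℚ`) and `surjective_resolvent_restrict_of_not_isSquare`;
* §0 the side condition is AUTOMATIC on C2's domain: `not_isSquare_two_mul_Δ_of_isOrdinaryAt` — `W` globally minimal and good (ordinary) at `2` ⟹
  `Δ_W = Δ_min` is odd ⟹ `2Δ_W ≡ 2, 6 (mod 8)` is not a square.

Part B (`…SignFreeMu`) runs the descent itself on these inputs. Compare att-p5 g28/g29's `…SexticFukudaIndex.forall_sq_ne_two_…_emod_four_eq_three`
(`√2 ∉ T` for `Δ_min ≡ 3 (mod 4)` via ramification indices); the field-degree argument here needs no integrality and no congruence on `Δ`.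

References: [Washington1997] §13.1; [MilneFT2022] Ch. 3; [SilvermanAEC2009] III.§1, VII.5 Prop. 5.1(a); [BiasseEtAl2022] Def. 2.1; tree: parts 1–2,
`ZpExtensionRestrictTwoSqrtTwo` (cell bsd-2adic), `NoEverywhereGoodReductionRat`, `GlobalMinimalModel`. (`2 ∉ ℚ²` is the tree's
`Literature.Barriers.BirchSwinnertonDyer.curve480a1.not_isSquare_two`; it is re-derived inline in two lines where used, to keep the `2`-descent barrier file out of
this import closure.)
-/

set_option linter.dupNamespace false
set_option autoImplicit false

noncomputable section

open scoped Classical NumberField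

namespace Summit.BirchSwinnertonDyer.BirchSwinnertonDyer.Theorems.AlignedTransportAtTwoSexticNormRelationDescentSignFree

open NumberField Polynomial WeierstrassCurve IntermediateField Field
  Literature.NumberTheory.EllipticCurves Literature.NumberTheory.EllipticCurves.Greenberg1999
  Literature.NumberTheory.EllipticCurves.DokchitserDokchitser2012
  Literature.NumberTheory.EllipticCurves.ZpExtension Literature.NumberTheory.GaloisRepresentations
  Literature.NumberTheory.IwasawaTheory Literature.NumberTheory.NumberFields
  Summit.BirchSwinnertonDyer.BirchSwinnertonDyer.Theorems.AlignedTransportAtTwoFineRoad.DivisionCubic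
  Summit.BirchSwinnertonDyer.BirchSwinnertonDyer.Theorems.AlignedTransportAtTwoFineRoad.TowerImageDelta
  Summit.BirchSwinnertonDyer.BirchSwinnertonDyer.Theorems.AlignedTransportAtTwoCubicClosureParity
  Summit.BirchSwinnertonDyer.BirchSwinnertonDyer.Theorems.AlignedTransportAtTwoSexticTowerGrowth
  Summit.BirchSwinnertonDyer.BirchSwinnertonDyer.Theorems.AlignedTransportAtTwoSexticNormRelationDescent
  Summit.BirchSwinnertonDyer.BirchSwinnertonDyer.Theorems.AlignedTransportAtTwoSexticNormRelationDescentMu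

/-! ## §0 Arithmetic: `2Δ_min` is not a square for a curve good at `2` -/

variable (W : WeierstrassCurve ℚ) [W.IsElliptic]

omit [W.IsElliptic] in
/-- **On C2's domain the side condition `¬ IsSquare (2·Δ_W)` is automatic**: `W` globally minimal with good ordinary reduction at `2` has odd
`Δ_W = Δ_min` (`2 ∣ Δ_min ⟹` bad reduction at `2`), and twice an odd integer is `≡ 2, 6 (mod 8)`, never a square. [cite: SilvermanAEC2009, VII.5 Prop. 5.1(a)] -/
theorem not_isSquare_two_mul_Δ_of_isOrdinaryAt [W.IsGloballyMinimal] (hord : IsOrdinaryAt W 2) : ¬ IsSquare (2 * W.Δ) := by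
  haveI : Fact (Nat.Prime 2) := ⟨Nat.prime_two⟩
  have hodd : ¬ (2 : ℤ) ∣ minimalDiscriminantInt W :=
    fun h ↦ W.not_hasGoodReductionAtPrime_of_dvd_minimalDiscriminantInt 2 (by exact_mod_cast h) hord.1
  rw [← cast_minimalDiscriminantInt W, show (2 : ℚ) * (minimalDiscriminantInt W : ℚ) = ((2 * minimalDiscriminantInt W : ℤ) : ℚ) by push_cast; ring,
    Rat.isSquare_intCast_iff]
  intro hsq
  rcases emod_eight_of_isSquare hsq with h | h | h <;> omega

/-! ## §1 The Galois bookkeeping of part 1 under `¬ IsSquare Δ_W` only -/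

/-- `[ℚ(δ) : ℚ] = 2` inside `T` for `δ² = Δ_W` NOT a square (sign-free form of part 1's `finrank_adjoin_delta`). [cite: DokchitserDokchitserMathZ2012, Theorem (1)] -/
theorem finrank_adjoin_delta_of_not_isSquare (hsq : ¬ IsSquare W.Δ) :
    Module.finrank ℚ ℚ⟮(⟨4 * delta W two_ne_zero, (delta_mem_and_sq W).1⟩ : W.divisionField 2)⟯ = 2 := by
  refine finrank_adjoin_eq_two_of_sq_eq (q := W.Δ) ?_ hsq
  apply (algebraMap (W.divisionField 2) (AlgebraicClosure ℚ)).injective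
  rw [map_pow, map_ratCast]
  exact (delta_mem_and_sq W).2

/-- `|Gal(T/ℚ)| = 6` (sign-free form of part 1's `natCard_gal`). [cite: SilvermanAEC2009, III.§1] -/
theorem natCard_gal_of_not_isSquare (ht : ∀ x : ℚ, ¬ HasRationalTwoTorsionX W x) (hsq : ¬ IsSquare W.Δ) :
    Nat.card (W.divisionField 2 ≃ₐ[ℚ] W.divisionField 2) = 6 := by
  haveI : IsGalois ℚ (W.divisionField 2) := W.isGalois_divisionField 2
  rw [IsGalois.card_aut_eq_finrank, finrank_divisionField_two_eq_six W ht hsq]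

/-- The fixing subgroup of `ℚ(β_j) ⊆ T` has order `2` (sign-free form of part 1). [cite: MilneFT2022, Ch. 3 (fundamental theorem)] -/
theorem natCard_fixingSubgroup_adjoin_xT_of_not_isSquare (ht : ∀ x : ℚ, ¬ HasRationalTwoTorsionX W x) (hsq : ¬ IsSquare W.Δ) (j : Fin 3) :
    Nat.card (ℚ⟮(⟨xT W two_ne_zero j, xT_mem W j⟩ : W.divisionField 2)⟯.fixingSubgroup) = 2 := by
  haveI : IsGalois ℚ (W.divisionField 2) := W.isGalois_divisionField 2
  set E := ℚ⟮(⟨xT W two_ne_zero j, xT_mem W j⟩ : W.divisionField 2)⟯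
  rw [IsGalois.card_fixingSubgroup_eq_finrank E]
  have htower := Module.finrank_mul_finrank ℚ E (W.divisionField 2)
  rw [finrank_adjoin_xT W ht j, finrank_divisionField_two_eq_six W ht hsq] at htower
  omega

/-- The fixing subgroup of `ℚ(δ) ⊆ T` has order `3` (sign-free form of part 1). [cite: MilneFT2022, Ch. 3 (fundamental theorem)] -/
theorem natCard_fixingSubgroup_adjoin_delta_of_not_isSquare (ht : ∀ x : ℚ, ¬ HasRationalTwoTorsionX W x) (hsq : ¬ IsSquare W.Δ) :
    Nat.card (ℚ⟮(⟨4 * delta W two_ne_zero, (delta_mem_and_sq W).1⟩ : W.divisionField 2)⟯.fixingSubgroup) = 3 := by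
  haveI : IsGalois ℚ (W.divisionField 2) := W.isGalois_divisionField 2
  set D := ℚ⟮(⟨4 * delta W two_ne_zero, (delta_mem_and_sq W).1⟩ : W.divisionField 2)⟯
  rw [IsGalois.card_fixingSubgroup_eq_finrank D]
  have htower := Module.finrank_mul_finrank ℚ D (W.divisionField 2)
  rw [finrank_adjoin_delta_of_not_isSquare W hsq, finrank_divisionField_two_eq_six W ht hsq] at htower
  omega

/-- `δ ∉ ℚ(β_j)` (degree `2 ∤ 3`; sign-free form of part 1). [cite: DokchitserDokchitserMathZ2012, Theorem (1)] -/
theorem delta_not_mem_adjoin_xT_of_not_isSquare (ht : ∀ x : ℚ, ¬ HasRationalTwoTorsionX W x) (hsq : ¬ IsSquare W.Δ) (j : Fin 3) :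
    (⟨4 * delta W two_ne_zero, (delta_mem_and_sq W).1⟩ : W.divisionField 2) ∉
      ℚ⟮(⟨xT W two_ne_zero j, xT_mem W j⟩ : W.divisionField 2)⟯ := by
  intro hmem
  have hle : ℚ⟮(⟨4 * delta W two_ne_zero, (delta_mem_and_sq W).1⟩ : W.divisionField 2)⟯ ≤
      ℚ⟮(⟨xT W two_ne_zero j, xT_mem W j⟩ : W.divisionField 2)⟯ := adjoin_simple_le_iff.mpr hmem
  have hdvd := IntermediateField.finrank_dvd_of_le_right hle
  rw [finrank_adjoin_delta_of_not_isSquare W hsq, finrank_adjoin_xT W ht j] at hdvd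
  omega

/-- The three cubic subfields have pairwise distinct fixing subgroups (sign-free form of part 1). [cite: MilneFT2022, Ch. 3 (fundamental theorem)] -/
theorem fixingSubgroup_adjoin_xT_ne_of_not_isSquare (ht : ∀ x : ℚ, ¬ HasRationalTwoTorsionX W x) (hsq : ¬ IsSquare W.Δ) {i j : Fin 3} (hij : i ≠ j) :
    (ℚ⟮(⟨xT W two_ne_zero i, xT_mem W i⟩ : W.divisionField 2)⟯).fixingSubgroup ≠
      (ℚ⟮(⟨xT W two_ne_zero j, xT_mem W j⟩ : W.divisionField 2)⟯).fixingSubgroup := by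
  haveI : IsGalois ℚ (W.divisionField 2) := W.isGalois_divisionField 2
  intro heq
  have hE : ℚ⟮(⟨xT W two_ne_zero i, xT_mem W i⟩ : W.divisionField 2)⟯ = ℚ⟮(⟨xT W two_ne_zero j, xT_mem W j⟩ : W.divisionField 2)⟯ := by
    rw [← IsGalois.fixedField_fixingSubgroup ℚ⟮(⟨xT W two_ne_zero i, xT_mem W i⟩ : W.divisionField 2)⟯, heq,
      IsGalois.fixedField_fixingSubgroup]
  have hi : (⟨xT W two_ne_zero i, xT_mem W i⟩ : W.divisionField 2) ∈ ℚ⟮(⟨xT W two_ne_zero i, xT_mem W i⟩ : W.divisionField 2)⟯ :=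
    mem_adjoin_simple_self ℚ _
  have hj : (⟨xT W two_ne_zero j, xT_mem W j⟩ : W.divisionField 2) ∈ ℚ⟮(⟨xT W two_ne_zero i, xT_mem W i⟩ : W.divisionField 2)⟯ := by
    rw [hE]; exact mem_adjoin_simple_self ℚ _
  exact delta_not_mem_adjoin_xT_of_not_isSquare W ht hsq i (delta_mem_of_mem_of_mem W _ hij hi hj)

/-- **The `S₃` norm relation `3 = N_{H₀} + N_{H₁} + N_{H₂} + N_C − N_G` in `ℤ[Gal(ℚ(W[2])/ℚ)]` for BOTH signs of `Δ_W`** (sign-free form of part 1's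
`normRelation_gal`; g28's `NormRelation.normRelation_card_six` at the group of order `6`). [cite: BiasseEtAl2022, Def. 2.1 and Prop. 3.7] -/
theorem normRelation_gal_of_not_isSquare (ht : ∀ x : ℚ, ¬ HasRationalTwoTorsionX W x) (hsq : ¬ IsSquare W.Δ)
    [hF : ∀ i, Fintype ↥((![(ℚ⟮(⟨xT W two_ne_zero 0, xT_mem W 0⟩ : W.divisionField 2)⟯).fixingSubgroup,
      (ℚ⟮(⟨xT W two_ne_zero 1, xT_mem W 1⟩ : W.divisionField 2)⟯).fixingSubgroup,
      (ℚ⟮(⟨xT W two_ne_zero 2, xT_mem W 2⟩ : W.divisionField 2)⟯).fixingSubgroup,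
      (ℚ⟮(⟨4 * delta W two_ne_zero, (delta_mem_and_sq W).1⟩ : W.divisionField 2)⟯).fixingSubgroup, ⊤] :
        Fin 5 → Subgroup (W.divisionField 2 ≃ₐ[ℚ] W.divisionField 2)) i)]
    (g : W.divisionField 2 ≃ₐ[ℚ] W.divisionField 2) :
    (∑ i : Fin 5, ∑ x : (W.divisionField 2 ≃ₐ[ℚ] W.divisionField 2),
      ∑ h : (![(ℚ⟮(⟨xT W two_ne_zero 0, xT_mem W 0⟩ : W.divisionField 2)⟯).fixingSubgroup,
        (ℚ⟮(⟨xT W two_ne_zero 1, xT_mem W 1⟩ : W.divisionField 2)⟯).fixingSubgroup,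
        (ℚ⟮(⟨xT W two_ne_zero 2, xT_mem W 2⟩ : W.divisionField 2)⟯).fixingSubgroup,
        (ℚ⟮(⟨4 * delta W two_ne_zero, (delta_mem_and_sq W).1⟩ : W.divisionField 2)⟯).fixingSubgroup, ⊤] :
          Fin 5 → Subgroup (W.divisionField 2 ≃ₐ[ℚ] W.divisionField 2)) i,
        (![fun x => if x = 1 then (1 : ℤ) else 0, fun x => if x = 1 then (1 : ℤ) else 0,
            fun x => if x = 1 then (1 : ℤ) else 0, fun x => if x = 1 then (1 : ℤ) else 0,
            fun x => if x = 1 then (-1 : ℤ) else 0] : Fin 5 → (W.divisionField 2 ≃ₐ[ℚ] W.divisionField 2) → ℤ) i x *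
          (fun (_ : Fin 5) (y : W.divisionField 2 ≃ₐ[ℚ] W.divisionField 2) => if y = 1 then (1 : ℤ) else 0) i
            (((h : W.divisionField 2 ≃ₐ[ℚ] W.divisionField 2))⁻¹ * x⁻¹ * g)) =
      if g = 1 then ((3 : ℕ) : ℤ) else 0 :=
  NormRelation.normRelation_card_six (natCard_gal_of_not_isSquare W ht hsq) _ _ _ _
    (natCard_fixingSubgroup_adjoin_xT_of_not_isSquare W ht hsq 0) (natCard_fixingSubgroup_adjoin_xT_of_not_isSquare W ht hsq 1)
    (natCard_fixingSubgroup_adjoin_xT_of_not_isSquare W ht hsq 2)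
    (fixingSubgroup_adjoin_xT_ne_of_not_isSquare W ht hsq (by decide)) (fixingSubgroup_adjoin_xT_ne_of_not_isSquare W ht hsq (by decide))
    (fixingSubgroup_adjoin_xT_ne_of_not_isSquare W ht hsq (by decide)) (natCard_fixingSubgroup_adjoin_delta_of_not_isSquare W ht hsq) g

/-! ## §2 `√2 ∉ ℚ(W[2])` and `√2 ∉ ℚ(δ)` from `2Δ_W ∉ ℚ²` -/

omit [W.IsElliptic] in
/-- **Quadratic-extension lemma.** `L ⊇ F` fields of characteristic `0` with `[L : F] = 2`, `d ∈ L ∖ F`, `d² = m ∈ F`. If `x ∈ L` has `x² = 2` then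
`x ∈ F` or `2m` is a square in `F`. (Write `x = a + b·d` in the `F`-basis `1, d`: `x² = a² + b²m + 2ab·d = 2` forces `ab = 0`; `b = 0` gives `x = a ∈ F`,
`a = 0` gives `b²m = 2`, i.e. `(bm)² = 2m`.) [folklore] -/
theorem mem_range_or_exists_sq_eq_two_mul {F L : Type*} [Field F] [Field L] [Algebra F L] [CharZero L]
    (h2 : Module.finrank F L = 2) {d : L} {m : F} (hd : d ^ 2 = algebraMap F L m) (hdF : d ∉ Set.range (algebraMap F L))
    {x : L} (hx : x ^ 2 = 2) : x ∈ Set.range (algebraMap F L) ∨ ∃ c : F, c ^ 2 = 2 * m := by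
  -- `1, d` are linearly independent over `F`, hence an `F`-basis of `L`
  have hli : LinearIndependent F ![(1 : L), d] := by
    rw [LinearIndependent.pair_iff]
    intro s t hst
    rw [Algebra.smul_def, Algebra.smul_def, mul_one] at hst
    by_cases ht : t = 0
    · refine ⟨?_, ht⟩
      rw [ht, map_zero, zero_mul, add_zero] at hst
      exact (map_eq_zero_iff _ (algebraMap F L).injective).mp hst
    · exfalso
      apply hdF
      refine ⟨-s / t, ?_⟩
      have htL : algebraMap F L t ≠ 0 := (map_ne_zero_iff _ (algebraMap F L).injective).mpr ht
      rw [map_div₀, map_neg, div_eq_iff htL]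
      linear_combination -hst
  have hspan := hli.span_eq_top_of_card_eq_finrank (by rw [Fintype.card_fin, h2])
  rw [Matrix.range_cons_cons_empty] at hspan
  have hxmem : x ∈ Submodule.span F ({(1 : L), d} : Set L) := by rw [hspan]; exact Submodule.mem_top
  obtain ⟨a, b, hab⟩ := Submodule.mem_span_pair.mp hxmem
  rw [Algebra.smul_def, Algebra.smul_def, mul_one] at hab
  -- compare coefficients of `x² = 2` in the basis `1, d`
  have key : (a ^ 2 + b ^ 2 * m - 2) • (1 : L) + (2 * a * b) • d = 0 := by
    rw [Algebra.smul_def, Algebra.smul_def, mul_one]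
    simp only [map_sub, map_add, map_mul, map_pow, map_ofNat]
    rw [← hab] at hx
    linear_combination hx - (algebraMap F L b) ^ 2 * hd
  obtain ⟨h1, hab0⟩ := (LinearIndependent.pair_iff.mp hli) _ _ key
  have hab0' : algebraMap F L a = 0 ∨ algebraMap F L b = 0 := by
    have h := congrArg (algebraMap F L) hab0
    rw [map_mul, map_mul, map_ofNat, map_zero] at h
    rcases mul_eq_zero.mp h with h' | h'
    · rcases mul_eq_zero.mp h' with h'' | h''
      · exact absurd h'' two_ne_zero
      · exact Or.inl h''
    · exact Or.inr h'
  rcases hab0' with ha | hb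
  · right
    have ha' : a = 0 := (map_eq_zero_iff _ (algebraMap F L).injective).mp ha
    refine ⟨b * m, ?_⟩
    rw [ha'] at h1
    have hbm : b ^ 2 * m = 2 := by linear_combination h1
    linear_combination m * hbm
  · left
    exact ⟨a, by rw [← hab, hb, zero_mul, add_zero]⟩

/-- ★ **`√2 ∉ ℚ(W[2])`** for `W/ℚ` elliptic with no rational `2`-torsion abscissa, `Δ_W ∉ ℚ²` and `2Δ_W ∉ ℚ²`: over the cubic field `F = ℚ(β₀) ⊆ T`
(`[T : F] = 2`, `T = F(δ)`), an `x ∈ T` with `x² = 2` would give `√2 ∈ F` or `√(2Δ_W) ∈ F` (§2 lemma), a quadratic subfield of a field of degree `3`.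
[cite: Washington1997, §13.1] [cite: SilvermanAEC2009, III.§1] -/
theorem forall_sq_ne_two_divisionField_two (ht : ∀ x : ℚ, ¬ HasRationalTwoTorsionX W x) (hsq : ¬ IsSquare W.Δ) (h2Δ : ¬ IsSquare (2 * W.Δ)) :
    ∀ x : W.divisionField 2, x ^ 2 ≠ 2 := by
  intro x hx
  haveI : IsGalois ℚ (W.divisionField 2) := W.isGalois_divisionField 2
  set E := ℚ⟮(⟨xT W two_ne_zero 0, xT_mem W 0⟩ : W.divisionField 2)⟯ with hEdef
  set d : W.divisionField 2 := ⟨4 * delta W two_ne_zero, (delta_mem_and_sq W).1⟩ with hddef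
  have hE3 : Module.finrank ℚ E = 3 := finrank_adjoin_xT W ht 0
  have htower := Module.finrank_mul_finrank ℚ E (W.divisionField 2)
  rw [hE3, finrank_divisionField_two_eq_six W ht hsq] at htower
  have hTE : Module.finrank E (W.divisionField 2) = 2 := by omega
  -- `d² = Δ_W ∈ E`, `d ∉ E`
  have hdT : d ^ 2 = ((W.Δ : ℚ) : W.divisionField 2) := by
    apply (algebraMap (W.divisionField 2) (AlgebraicClosure ℚ)).injective
    rw [map_pow, map_ratCast]
    exact (delta_mem_and_sq W).2
  have hd : d ^ 2 = algebraMap E (W.divisionField 2) ((W.Δ : ℚ) : E) := by rw [map_ratCast]; exact hdT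
  have hdE : d ∉ Set.range (algebraMap E (W.divisionField 2)) := by
    rintro ⟨e, he⟩
    apply delta_not_mem_adjoin_xT_of_not_isSquare W ht hsq 0
    change d ∈ E
    rw [← he]
    exact e.2
  -- no quadratic subfield `ℚ(y) ⊆ E`, `y² = q ∉ ℚ²`
  have hnoquad : ∀ (y : W.divisionField 2) (q : ℚ), y ^ 2 = (q : W.divisionField 2) → ¬ IsSquare q → y ∈ E → False := by
    intro y q hy hq hyE
    have hle : ℚ⟮y⟯ ≤ E := adjoin_simple_le_iff.mpr hyE
    have hdvd := IntermediateField.finrank_dvd_of_le_right hle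
    rw [finrank_adjoin_eq_two_of_sq_eq hy hq, hE3] at hdvd
    omega
  rcases mem_range_or_exists_sq_eq_two_mul hTE hd hdE hx with ⟨e, he⟩ | ⟨c, hc⟩
  · have h2sq : ¬ IsSquare (2 : ℚ) := by  -- cf. the tree's `curve480a1.not_isSquare_two`
      rw [show (2 : ℚ) = ((2 : ℕ) : ℚ) by norm_num, Rat.isSquare_natCast_iff]
      rintro ⟨r, hr⟩
      have hr2 : r ≤ 2 := by nlinarith
      interval_cases r <;> omega
    exact hnoquad x 2 (by rw [hx]; norm_num) h2sq (by rw [← he]; exact e.2)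
  · refine hnoquad (c : W.divisionField 2) (2 * W.Δ) ?_ h2Δ c.2
    have h := congrArg (algebraMap E (W.divisionField 2)) hc
    rw [map_pow, map_mul, map_ofNat, map_ratCast] at h
    rw [Rat.cast_mul, Rat.cast_ofNat]
    exact h

/-- **`√2 ∉ ℚ(δ)`** (`δ = 4δ₀`, `δ² = Δ_W ∉ ℚ²`, `2Δ_W ∉ ℚ²`): `ℚ(δ) = ℚ ⊕ ℚδ` and the §2 lemma over `F = ℚ`. [cite: Washington1997, §13.1] -/
theorem forall_sq_ne_two_resolvent (hsq : ¬ IsSquare W.Δ) (h2Δ : ¬ IsSquare (2 * W.Δ)) :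
    ∀ x : ↥ℚ⟮4 * delta W two_ne_zero⟯, x ^ 2 ≠ 2 := by
  intro x hx
  have hδ := (delta_mem_and_sq W).2
  have h2 : Module.finrank ℚ ↥ℚ⟮4 * delta W two_ne_zero⟯ = 2 := finrank_adjoin_eq_two_of_sq_eq hδ hsq
  set d : ↥ℚ⟮4 * delta W two_ne_zero⟯ := ⟨4 * delta W two_ne_zero, mem_adjoin_simple_self ℚ _⟩ with hddef
  have hd' : d ^ 2 = ((W.Δ : ℚ) : ↥ℚ⟮4 * delta W two_ne_zero⟯) := by
    apply Subtype.ext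
    push_cast
    exact hδ
  have hd : d ^ 2 = algebraMap ℚ ↥ℚ⟮4 * delta W two_ne_zero⟯ W.Δ := by rw [eq_ratCast]; exact hd'
  have hdQ : d ∉ Set.range (algebraMap ℚ ↥ℚ⟮4 * delta W two_ne_zero⟯) := by
    rintro ⟨q, hq⟩
    apply hsq
    refine ⟨q, ?_⟩
    have h := hd
    rw [← hq, ← map_pow] at h
    have h' := (algebraMap ℚ ↥ℚ⟮4 * delta W two_ne_zero⟯).injective h
    rw [← h', sq]
  rcases mem_range_or_exists_sq_eq_two_mul h2 hd hdQ hx with ⟨a, ha⟩ | ⟨c, hc⟩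
  · have h2sq : ¬ IsSquare (2 : ℚ) := by  -- cf. the tree's `curve480a1.not_isSquare_two`
      rw [show (2 : ℚ) = ((2 : ℕ) : ℚ) by norm_num, Rat.isSquare_natCast_iff]
      rintro ⟨r, hr⟩
      have hr2 : r ≤ 2 := by nlinarith
      interval_cases r <;> omega
    apply h2sq
    refine ⟨a, ?_⟩
    have h : (algebraMap ℚ ↥ℚ⟮4 * delta W two_ne_zero⟯ a) ^ 2 = algebraMap ℚ ↥ℚ⟮4 * delta W two_ne_zero⟯ 2 := by rw [ha, hx, map_ofNat]
    rw [← map_pow] at h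
    have h' := (algebraMap ℚ ↥ℚ⟮4 * delta W two_ne_zero⟯).injective h
    rw [← h', sq]
  · exact h2Δ ⟨c, by rw [← sq, hc]⟩

/-! ## §3 `ℚ(W[2]) ∩ ℚ_∞ = ℚ` and `ℚ(δ) ∩ ℚ_∞ = ℚ`, sign-free -/

/-- ★ **`κ ∘ res : Γ_T → ℤ₂` is onto for BOTH signs of `Δ_W`** (`κ` the cyclotomic `ℤ₂`-extension of `ℚ`, `T = ℚ(W[2])` with `[T:ℚ] = 6`, `4 ∤ 6`, `√2 ∉ T`):
sign-free form of part 1's `surjective_gal_restrict`. [cite: Washington1997, §13.1] -/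
theorem surjective_gal_restrict_of_not_isSquare (ht : ∀ x : ℚ, ¬ HasRationalTwoTorsionX W x) (hsq : ¬ IsSquare W.Δ) (h2Δ : ¬ IsSquare (2 * W.Δ))
    (κ : ZpExtension ℚ 2) (hκ : κ.IsCyclotomic) :
    haveI : NumberField (W.divisionField 2) := NumberField.mk
    Function.Surjective (κ.toContinuousMonoidHom.comp (absGaloisRestrict ℚ (W.divisionField 2))) := by
  haveI : NumberField (W.divisionField 2) := NumberField.mk
  refine surjective_comp_absGaloisRestrict_of_forall_sq_ne_two κ (W.divisionField 2) hκ ?_ (forall_sq_ne_two_divisionField_two W ht hsq h2Δ)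
  rw [finrank_divisionField_two_eq_six W ht hsq]; decide

/-- **`κ ∘ res : Γ_{ℚ(δ)} → ℤ₂` is onto for BOTH signs of `Δ_W`** (`[ℚ(δ):ℚ] = 2`, `√2 ∉ ℚ(δ)`): sign-free form of part 2's `surjective_resolvent_restrict`.
[cite: Washington1997, §13.1] -/
theorem surjective_resolvent_restrict_of_not_isSquare (hsq : ¬ IsSquare W.Δ) (h2Δ : ¬ IsSquare (2 * W.Δ)) (κ : ZpExtension ℚ 2) (hκ : κ.IsCyclotomic) :
    haveI : FiniteDimensional ℚ ↥ℚ⟮4 * delta W two_ne_zero⟯ :=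
      IntermediateField.adjoin.finiteDimensional ((AlgebraicClosure.isAlgebraic ℚ).isAlgebraic _).isIntegral
    haveI : NumberField ↥ℚ⟮4 * delta W two_ne_zero⟯ := NumberField.mk
    Function.Surjective (κ.toContinuousMonoidHom.comp (absGaloisRestrict ℚ ↥ℚ⟮4 * delta W two_ne_zero⟯)) := by
  haveI : FiniteDimensional ℚ ↥ℚ⟮4 * delta W two_ne_zero⟯ :=
    IntermediateField.adjoin.finiteDimensional ((AlgebraicClosure.isAlgebraic ℚ).isAlgebraic _).isIntegral
  haveI : NumberField ↥ℚ⟮4 * delta W two_ne_zero⟯ := NumberField.mk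
  refine surjective_comp_absGaloisRestrict_of_forall_sq_ne_two κ _ hκ ?_ (forall_sq_ne_two_resolvent W hsq h2Δ)
  rw [finrank_adjoin_eq_two_of_sq_eq (delta_mem_and_sq W).2 hsq]; decide

end Summit.BirchSwinnertonDyer.BirchSwinnertonDyer.Theorems.AlignedTransportAtTwoSexticNormRelationDescentSignFree

end
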